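import Mathlib
import Literature.AlgebraicGeometry.Resolution.UnitChainTauOneRational
import Literature.AlgebraicGeometry.Resolution.CompletedChainDescentTools
import Literature.AlgebraicGeometry.Resolution.PointStepChartExclusion
import Literature.AlgebraicGeometry.Resolution.AdaptedTauOneForms
import Literature.AlgebraicGeometry.Resolution.ExcellentRings
import HarnessLib

/-!
# A good tail of the `τ = 1` chain is CONTRACT v2 (`τ = 1` endgame, OPTION R, brick R-5: S-tail)

Topic: `Literature/AlgebraicGeometry/Resolution`. V. Cossart, U. Jannsen, S. Saito, LNM 2270 (2020), proof of
Thm. 13.7 (pp. 157–159) and Claim 13.8 [cite: CossartJannsenSaito2020, Thm. 13.7]; V. Cossart, O. Piltant,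
J. Algebra 320 (2008), proof of Prop. 4.4 (p. 11) [cite: CossartPiltant2008, Prop. 4.4].

OURS (the tail step of the completed-chain descent `CompletedChainDescent`): in the frame of CONTRACT v3′
(`false_of_fullChain_tau_one'`: regular local rings `R_n` of dimension `3`, local maps `φ_n`, ideals `I_n`,
exceptional parameters `u_n`, the trichotomy `hpt_cases` at point levels, the chart `hcurve` at curve levels,
the centre clauses `hPsucc_pt` / `hPsucc_cv`), suppose that from a POINT level `n₀` on every step is GOOD —
the residue field does not grow and the exceptional parameter propagates, `(u_{n+1}) = (φ_n u_n)` — and that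
an algebraic label `c = (l, c₁, c₂)` adapted to `I_{n₀}` with `(c₁) = (u_{n₀})` is given. Then `False`:
the chain re-based at `n₀`, with exceptional parameters the `φ`-iterates of `u_{n₀}` and the label
`(l, u_{n₀}, c₂)`, satisfies every hypothesis of CONTRACT v2 `false_of_unitChain_tau_one_rational` (the
`∀`-label point clause by the trichotomy and `PointStepChartExclusion.hpoint_of_pointCases`; the colon,
curve and centre clauses by associates). F-71 / T1 NOT proved here; no summit statement is proved;
resolution in dimension `≥ 4` / positive characteristic is NOT proved. AI-written; weaker than expert review.
-/

noncomputable section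

open IsLocalRing MvPolynomial

namespace Literature.AlgebraicGeometry.Resolution

universe u

/-- **S-tail (OURS). A good tail of the `τ = 1` chain contradicts CONTRACT v2.** See the module docstring.
[cite: CossartJannsenSaito2020, Thm. 13.7 (proof), Claim 13.8, Thm. 8.24] [cite: CossartPiltant2008, Prop. 4.4 (proof, p. 11)] -/
theorem false_of_goodTail
    (Rn : ℕ → Type u) [∀ n, CommRing (Rn n)] [∀ n, IsRegularLocalRing (Rn n)]
    (hdim : ∀ n, ringKrullDim (Rn n) = 3) (φ : ∀ n, Rn n →+* Rn (n + 1)) [∀ n, IsLocalHom (φ n)]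
    (I : ∀ n, Ideal (Rn n)) {μ : ℕ} (hμ : 1 ≤ μ) (u : ∀ n, Rn n)
    (pt : ℕ → Prop) (hG : ∀ n, IsGRing (Rn n))
    (hIμ : ∀ n, I n ≤ maximalIdeal (Rn n) ^ μ) (hIne : ∀ n, ¬ I n ≤ maximalIdeal (Rn n) ^ (μ + 1))
    (hτ : ∀ n (c : Fin 3 → Rn n), Ideal.span {c 0, c 1, c 2} = maximalIdeal (Rn n) →
      hironakaTauAt c (I n) μ = 1)
    (P : ∀ n, Ideal (Rn n))
    (hexc_pt : ∀ n, pt n → (maximalIdeal (Rn n)).map (φ n) = Ideal.span {u (n + 1)})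
    (hI : ∀ n, I (n + 1) = ((I n).map (φ n)).colon {u (n + 1) ^ μ})
    (hpt_cases : ∀ n, pt n → ∀ (c : Fin 3 → Rn n), Ideal.span {c 0, c 1, c 2} = maximalIdeal (Rn n) →
      (∀ G ∈ initialForms c (I n) μ, ∃ a : ResidueField (Rn n), G = C a * X 0 ^ μ) →
      (Function.Surjective (ResidueField.map (φ n)) ∧
        ∃ (a : Rn n) (y' w' : Rn (n + 1)), φ n (c 0) = φ n (c 1) * y' ∧ φ n (c 2 - a * c 1) = φ n (c 1) * w' ∧
          Ideal.span {y', φ n (c 1), w'} = maximalIdeal (Rn (n + 1))) ∨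
      (¬ Function.Surjective (ResidueField.map (φ n)) ∧
        ∃ (t : Rn (n + 1)) (Q : Polynomial (Rn n)) (y' : Rn (n + 1)),
          φ n (c 0) = φ n (c 1) * y' ∧ φ n (c 2) = φ n (c 1) * t ∧ Q.Monic ∧
          2 ≤ (Q.map (residue (Rn n))).natDegree ∧ Irreducible (Q.map (residue (Rn n))) ∧
          (∀ G : Polynomial (Rn n), Polynomial.eval₂ (φ n) t G ∈ maximalIdeal (Rn (n + 1)) ↔
            Q.map (residue (Rn n)) ∣ G.map (residue (Rn n))) ∧
          (∀ r : ResidueField (Rn (n + 1)), ∃ G : Polynomial (Rn n), residue (Rn (n + 1)) (Polynomial.eval₂ (φ n) t G) = r) ∧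
          Ideal.span {y', φ n (c 1), Polynomial.eval₂ (φ n) t Q} = maximalIdeal (Rn (n + 1))) ∨
      (Function.Surjective (ResidueField.map (φ n)) ∧
        ∃ (y' v' : Rn (n + 1)), φ n (c 0) = φ n (c 2) * y' ∧ φ n (c 1) = φ n (c 2) * v' ∧
          Ideal.span {y', v', φ n (c 2)} = maximalIdeal (Rn (n + 1))))
    (hIP : ∀ n, ¬ pt n → I n ≤ P n ^ μ)
    (hcurve : ∀ n, ¬ pt n → ∀ (y v w : Rn n), Ideal.span {v} = Ideal.span {u n} → Ideal.span {y, v} = P n →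
      Ideal.span {y, v, w} = maximalIdeal (Rn n) →
      (∀ G ∈ initialForms ![y, v, w] (I n) μ, ∃ a : ResidueField (Rn n), G = C a * X 0 ^ μ) →
      Function.Surjective (ResidueField.map (φ n)) ∧
      ∃ y' : Rn (n + 1), φ n y = φ n v * y' ∧
        Ideal.span {y', φ n v, φ n w} = maximalIdeal (Rn (n + 1)))
    (hqis : ∀ n (𝔮 : Ideal (Rn n)) [𝔮.IsPrime], 𝔮 ≠ maximalIdeal (Rn n) → (pt n ∨ 𝔮 ≠ P n) →
      ¬ (I n).map (algebraMap (Rn n) (Localization.AtPrime 𝔮)) ≤ maximalIdeal (Localization.AtPrime 𝔮) ^ μ)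
    (hPsucc_pt : ∀ n, pt n → ¬ pt (n + 1) → ∀ (y w : Rn n) (y' : Rn (n + 1)),
      Ideal.span {y, u n, w} = maximalIdeal (Rn n) →
      (∀ G ∈ initialForms ![y, u n, w] (I n) μ, ∃ a : ResidueField (Rn n), G = C a * X 0 ^ μ) →
      φ n y = u (n + 1) * y' → Ideal.span {y', u (n + 1)} = P (n + 1))
    (hPsucc_cv : ∀ n, ¬ pt n → ¬ pt (n + 1) → ∀ (y v w : Rn n) (y' : Rn (n + 1)), Ideal.span {v} = Ideal.span {u n} →
      Ideal.span {y, v} = P n → Ideal.span {y, v, w} = maximalIdeal (Rn n) →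
      (∀ G ∈ initialForms ![y, v, w] (I n) μ, ∃ a : ResidueField (Rn n), G = C a * X 0 ^ μ) →
      φ n y = φ n v * y' →
      u (n + 1) ∈ P (n + 1) ∧ ∃ β ∈ maximalIdeal (Rn n), Ideal.span {y' + φ n β, u (n + 1)} = P (n + 1))
    -- the tail: a point level `n₀`, an adapted label there, and GOOD steps from `n₀` on
    (n₀ : ℕ) (hptn₀ : pt n₀)
    (c : Fin 3 → Rn n₀) (hc : Ideal.span {c 0, c 1, c 2} = maximalIdeal (Rn n₀))
    (hcu : Ideal.span {c 1} = Ideal.span {u n₀})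
    (hcad : ∀ G ∈ initialForms c (I n₀) μ, ∃ a : ResidueField (Rn n₀), G = C a * X 0 ^ μ)
    (hgood : ∀ n, n₀ ≤ n →
      Function.Surjective (ResidueField.map (φ n)) ∧ Ideal.span {u (n + 1)} = Ideal.span {φ n (u n)}) :
    False := by
  classical
  haveI : ∀ n, IsDomain (Rn n) := fun n => isDomain_of_isRegularLocalRing _
  -- the re-based exceptional parameters: the `φ`-iterates of `u n₀`
  let u' : ∀ k, Rn (n₀ + k) := fun k =>
    Nat.rec (motive := fun k => Rn (n₀ + k)) (u n₀) (fun k ih => φ (n₀ + k) ih) k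
  have hu' : ∀ k, u' (k + 1) = φ (n₀ + k) (u' k) := fun k => rfl
  have hspan : ∀ k, Ideal.span {u' k} = Ideal.span {u (n₀ + k)} := by
    intro k
    induction k with
    | zero => rfl
    | succ k ih =>
      rw [hu', ← map_span_singleton', ih, map_span_singleton']
      exact ((hgood (n₀ + k) (Nat.le_add_right _ _)).2).symm
  have hle : ∀ k, n₀ ≤ n₀ + k := fun k => Nat.le_add_right _ _
  -- level `n₀`: isolation, the label `(l, u n₀, c₂)`
  have hisol₀ : ∀ (𝔮 : Ideal (Rn n₀)) [𝔮.IsPrime], 𝔮 ≠ maximalIdeal (Rn n₀) →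
      ¬ (I n₀).map (algebraMap (Rn n₀) (Localization.AtPrime 𝔮)) ≤ maximalIdeal (Localization.AtPrime 𝔮) ^ μ :=
    fun 𝔮 _ h𝔮 => hqis n₀ 𝔮 h𝔮 (Or.inl hptn₀)
  set c₀ : Fin 3 → Rn n₀ := ![c 0, u n₀, c 2] with hc₀def
  have hc₀ : Ideal.span {c₀ 0, c₀ 1, c₀ 2} = maximalIdeal (Rn n₀) := by
    simp only [hc₀def, Matrix.cons_val_zero, Matrix.cons_val_one, Matrix.cons_val_two, Matrix.tail_cons,
      Matrix.head_cons]
    rw [← span_triple_eq_of_span_singleton_eq (c 0) (c 2) hcu]; exact hc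
  have hc₀ad : ∀ G ∈ initialForms c₀ (I n₀) μ, ∃ a : ResidueField (Rn n₀), G = C a * X 0 ^ μ :=
    forall_initialForms_of_eq_zero c (hdim n₀) (hIμ n₀) c₀ hc hc₀ rfl hcad
  have hne₀ := (pts_nonempty_and_alphaS_lt_of_isolated c₀ hc₀ (hdim n₀) hisol₀).1
  have hδ₀ : μ.factorial < deltaS c₀ (I n₀) μ := lt_deltaS_of_forall_initialForms c₀ hc₀ (hdim n₀) (hIμ n₀) hne₀ hc₀ad
  -- CONTRACT v2 on the re-based chain
  refine false_of_unitChain_tau_one_rational (fun k => Rn (n₀ + k)) (fun k => hdim (n₀ + k))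
    (fun k => φ (n₀ + k)) (fun k => I (n₀ + k)) hμ u' hu' (fun k => pt (n₀ + k)) hptn₀ (hG n₀) hisol₀ c₀ hc₀
    rfl hδ₀ (fun k => hIμ (n₀ + k)) (fun k => hIne (n₀ + k)) (fun k => hτ (n₀ + k))
    (fun k => (hgood (n₀ + k) (hle k)).1) (fun k => ?_) (fun k hk y w hgen had => ?_) (fun k => P (n₀ + k))
    (fun k => hIP (n₀ + k)) (fun k hk y w hP hgen had => ?_) (fun k => hqis (n₀ + k))
    (fun k hk hk1 y w y' hgen had hy => ?_) (fun k hk hk1 y w y' hP hgen had hy => ?_)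
  · -- `hI`: the colon by `(φ u'_k)^μ = unit · u_{n₀+k+1}^μ`
    exact (hI (n₀ + k)).trans (colon_singleton_pow_eq_of_span_singleton_eq _ (hspan (k + 1)).symm μ)
  · -- `hpoint`: the trichotomy, with `𝔪 R′ = (u_{n₀+k+1}) = (φ u'_k)`
    have hm : (maximalIdeal (Rn (n₀ + k))).map (φ (n₀ + k)) = Ideal.span {φ (n₀ + k) (u' k)} :=
      (hexc_pt (n₀ + k) hk).trans (hspan (k + 1)).symm
    exact hpoint_of_pointCases (φ (n₀ + k)) (hdim (n₀ + k + 1)) (hpt_cases (n₀ + k) hk) (u' k) hm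
      (hgood (n₀ + k) (hle k)).1 y w hgen had
  · -- `hcurve`
    exact (hcurve (n₀ + k) hk y (u' k) w (hspan k) hP hgen had).2
  · -- `hPsucc_pt`: through the label `(y, u_{n₀+k}, w)` and the units relating `u'` to `u`
    obtain ⟨ε₁, hε₁⟩ := Ideal.span_singleton_eq_span_singleton.mp (hspan (k + 1)).symm
    have hgen₁ : Ideal.span {y, u (n₀ + k), w} = maximalIdeal (Rn (n₀ + k)) := by
      rw [← span_triple_eq_of_span_singleton_eq y w (hspan k)]; exact hgen
    have had₁ : ∀ G ∈ initialForms ![y, u (n₀ + k), w] (I (n₀ + k)) μ,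
        ∃ a : ResidueField (Rn (n₀ + k)), G = C a * X 0 ^ μ :=
      forall_initialForms_of_eq_zero (![y, u' k, w]) (hdim (n₀ + k)) (hIμ (n₀ + k)) (![y, u (n₀ + k), w]) hgen
        hgen₁ rfl had
    have hy₁ : φ (n₀ + k) y = u (n₀ + k + 1) * (↑ε₁ * y') :=
      calc φ (n₀ + k) y = u' (k + 1) * y' := hy
        _ = u (n₀ + (k + 1)) * ↑ε₁ * y' := by rw [hε₁]
        _ = u (n₀ + k + 1) * (↑ε₁ * y') := mul_assoc _ _ _
    have h := hPsucc_pt (n₀ + k) hk hk1 y w (↑ε₁ * y') hgen₁ had₁ hy₁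
    rw [span_pair_eq_of_span_singleton_eq y' (hspan (k + 1)),
      ← span_pair_eq_of_span_singleton_eq' (u (n₀ + (k + 1))) (Ideal.span_singleton_mul_left_unit ε₁.isUnit y')]
    exact h
  · -- `hPsucc_cv`
    obtain ⟨hmem, β, hβ, hsp⟩ := hPsucc_cv (n₀ + k) hk hk1 y (u' k) w y' (hspan k) hP hgen had hy
    refine ⟨?_, β, hβ, ?_⟩
    · have hu'mem : u' (k + 1) ∈ Ideal.span {u (n₀ + k + 1)} :=
        (hspan (k + 1)) ▸ Ideal.mem_span_singleton_self (u' (k + 1))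
      obtain ⟨s, hs⟩ := Ideal.mem_span_singleton'.mp hu'mem
      rw [← hs]; exact (P (n₀ + k + 1)).mul_mem_left s hmem
    · rw [span_pair_eq_of_span_singleton_eq (y' + φ (n₀ + k) β) (hspan (k + 1))]; exact hsp

end Literature.AlgebraicGeometry.Resolution

end
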